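import Mathlib
import Literature.Computability.AlgebraicComplexity.StandardFamilies
import Literature.Computability.AlgebraicComplexity.QuasiPolynomialFormulasProofs
import Literature.Computability.AlgebraicComplexity.BorderQWordStages
import Summits.ValiantsHypothesis.ValiantsHypothesis.Theorems.ElementaryWordLengthWordLengthQPStubIbqAdd
import Summits.ValiantsHypothesis.ValiantsHypothesis.Theorems.ElementaryWordLengthWordLengthQPStubIbqSmul
import Summits.ValiantsHypothesis.ValiantsHypothesis.Theorems.ElementaryWordLengthWordLengthQPStubIbqSquare
import Summits.ValiantsHypothesis.ValiantsHypothesis.Theorems.ElementaryWordLengthWordLengthQPStubIbqCube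
import Summits.ValiantsHypothesis.ValiantsHypothesis.Theorems.ElementaryWordLengthWordLengthQPStubWordSLP

/-!
# Crux `WordLengthQP` (stmt-ValiantsHypothesis-6623), line `Sketch` (eps-order-ladder) —
stub `stub_perStage`: quasi-polynomial words for `E₀₂(per_n)` give quasi-polynomial integral
border Q-words for `per_n`

Bringmann–Ikenmeyer–Zuiddam's width-2 simulation (J. ACM 65 (2018) art. 32, §3) for the
permanent, in the integral form of `Literature/…/BorderQWordClosure.lean`, at quasi-polynomial
scale: for every `c` there is `c'` such that an affine elementary word of length
`≤ 2^((log₂ n + c)^c)` for `E₀₂(per_n)` yields an integral border Q-word for `per_n` of shift and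
length `≤ 2^((log₂ n + c')^c')` at precision `1`.  Chain: word ⇒ straight-line program of length
`2ℓ + 1` (`stub_wordSLP`) ⇒ `BorderQWord.exists_ibq_val_qp` (the stage recursion run with the
landed gadgets `stub_ibqAdd`, `stub_ibqSmul`, `stub_ibqCube`, `stub_ibqSquare`) at ONE common
polylogarithmic exponent `E(n) = (log₂ n + c₀)^c₀` dominating `n`, `n²` and `2 · 2^((log₂ n + c)^c) + 1`
(`exists_common_qp_exponent`) ⇒ `2^(100 E²) ≤ 2^((log₂ n + c')^c')` for `c' = 2c₀ + 100`.
-/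

-- `Summit.ValiantsHypothesis.ValiantsHypothesis.…` is the tree's mandated single-conjunct layout
-- (Sub = Summit), so the duplicated namespace component is intended.
set_option linter.dupNamespace false

noncomputable section

open MvPolynomial

namespace Summit.ValiantsHypothesis.ValiantsHypothesis.Cruxes.WordLengthQP.EpsOrderLadder

open Literature.Computability.AlgebraicComplexity

/-- Exponent bookkeeping: `a · ((ℓ + c₀)^c₀)² ≤ (ℓ + (2c₀ + a))^(2c₀ + a)` for `1 ≤ a`
(cf. `eighteen_mul_sq_le_pow`). -/
theorem perStage_mul_sq_le_pow (a c₀ ℓ : ℕ) (ha : 1 ≤ a) :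
    a * ((ℓ + c₀) ^ c₀) ^ 2 ≤ (ℓ + (2 * c₀ + a)) ^ (2 * c₀ + a) := by
  have hx : a ≤ ℓ + (2 * c₀ + a) := by omega
  have h1 : ((ℓ + c₀) ^ c₀) ^ 2 ≤ (ℓ + (2 * c₀ + a)) ^ (2 * c₀) := by
    calc ((ℓ + c₀) ^ c₀) ^ 2 = (ℓ + c₀) ^ (2 * c₀) := by rw [← pow_mul, Nat.mul_comm]
      _ ≤ (ℓ + (2 * c₀ + a)) ^ (2 * c₀) := Nat.pow_le_pow_left (by omega) _
  have h2 : a ≤ (ℓ + (2 * c₀ + a)) ^ a := hx.trans (Nat.le_self_pow (by omega) _)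
  calc a * ((ℓ + c₀) ^ c₀) ^ 2
      ≤ (ℓ + (2 * c₀ + a)) ^ a * (ℓ + (2 * c₀ + a)) ^ (2 * c₀) := Nat.mul_le_mul h2 h1
    _ = (ℓ + (2 * c₀ + a)) ^ (2 * c₀ + a) := by rw [← pow_add, Nat.add_comm a (2 * c₀)]

/-- The word-length bound `2 · 2^((log₂ n + c)^c) + 1` is quasi-polynomially bounded
(exponent `c + 2`). -/
theorem perStage_isQPBounded_wordBound (c : ℕ) :
    IsQPBounded fun n => 2 * 2 ^ ((Nat.log 2 n + c) ^ c) + 1 := by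
  refine ⟨c + 2, fun n => ?_⟩
  set ℓ := Nat.log 2 n
  have hx : 1 ≤ (ℓ + c) ^ c := by
    rcases Nat.eq_zero_or_pos c with rfl | hc
    · simp
    · exact Nat.one_le_pow _ _ (by omega)
  have h1 : 2 * 2 ^ ((ℓ + c) ^ c) + 1 ≤ 2 ^ ((ℓ + c) ^ c + 2) := by
    have h4 : (2 : ℕ) ^ 2 = 4 := by norm_num
    have hp : 1 ≤ 2 ^ ((ℓ + c) ^ c) := Nat.one_le_two_pow
    rw [pow_add, h4]; omega
  refine h1.trans (Nat.pow_le_pow_right (by norm_num) ?_)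
  calc (ℓ + c) ^ c + 2 ≤ (ℓ + c) ^ c * 4 := by omega
    _ ≤ (ℓ + (c + 2)) ^ c * (ℓ + (c + 2)) ^ 2 := by
        refine Nat.mul_le_mul (Nat.pow_le_pow_left (by omega) _) ?_
        calc 4 = 2 ^ 2 := by norm_num
          _ ≤ (ℓ + (c + 2)) ^ 2 := Nat.pow_le_pow_left (by omega) _
    _ = (ℓ + (c + 2)) ^ (c + 2) := by rw [← pow_add]

/-- **stub_perStage** (BIZ18 for the permanent, integral form, quasi-polynomial scale). -/
theorem stub_perStage :
    ∀ c : ℕ, ∃ c' : ℕ, ∀ n : ℕ,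
      (∃ w : List (Fin 3 × Fin 3 × ℂ × Option (Fin n × Fin n)),
        w.length ≤ 2 ^ ((Nat.log 2 n + c) ^ c) ∧
        (w.map (fun l => Matrix.transvection l.1 l.2.1
          (MvPolynomial.C l.2.2.1 * l.2.2.2.elim 1 MvPolynomial.X))).prod =
          Matrix.transvection (0 : Fin 3) 2
            (Literature.Computability.AlgebraicComplexity.perPoly (Fin n) ℂ)) →
      (∃ w : List ((Polynomial ℂ × Option (Fin n × Fin n)) × ℕ), w.length ≤ 2 ^ ((Nat.log 2 n + c') ^ c') ∧ ∃ M : ℕ, M ≤ 2 ^ ((Nat.log 2 n + c') ^ c') ∧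
        ∃ G : Matrix (Fin 2) (Fin 2) (MvPolynomial (Fin n × Fin n) (Polynomial ℂ)),
          (w.map (fun l => (!![MvPolynomial.C l.1.1 * l.1.2.elim 1 MvPolynomial.X,
              MvPolynomial.C (Polynomial.X ^ l.2); MvPolynomial.C (Polynomial.X ^ l.2), 0] :
                Matrix (Fin 2) (Fin 2) (MvPolynomial (Fin n × Fin n) (Polynomial ℂ))))).prod
            = (MvPolynomial.C (Polynomial.X ^ M) : MvPolynomial (Fin n × Fin n) (Polynomial ℂ)) •
                (!![MvPolynomial.map Polynomial.C (Literature.Computability.AlgebraicComplexity.perPoly (Fin n) ℂ), 1; 1, 0] :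
                  Matrix (Fin 2) (Fin 2) (MvPolynomial (Fin n × Fin n) (Polynomial ℂ)))
              + (MvPolynomial.C (Polynomial.X ^ (M + 1)) : MvPolynomial (Fin n × Fin n) (Polynomial ℂ)) • G) := by
  intro c
  -- one common polylogarithmic exponent `E(n) = (log₂ n + c₀)^c₀` dominating `n`, `n²` and the
  -- length `2 · 2^((log₂ n + c)^c) + 1` of the straight-line programs
  obtain ⟨c₀, hc₀⟩ := exists_common_qp_exponent (a := fun n => n) (b := fun n => n * n)
    (t := fun n => 2 * 2 ^ ((Nat.log 2 n + c) ^ c) + 1) ⟨1, fun n => by simp⟩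
    ⟨2, fun n => by nlinarith⟩ (perStage_isQPBounded_wordBound c)
  refine ⟨2 * c₀ + 100, fun n => ?_⟩
  rintro ⟨w, hwlen, hwprod⟩
  obtain ⟨S, hSlen, i, hi, hSval⟩ := stub_wordSLP w
  have hper : S.val i = perPoly (Fin n) ℂ := by
    rw [hSval, hwprod]
    simp [Matrix.transvection]
  obtain ⟨hE, hd, hcard, ht⟩ := hc₀ n
  set E := (Nat.log 2 n + c₀) ^ c₀ with hEdef
  have hlen : S.len ≤ 2 ^ E := by
    refine hSlen.trans (le_trans ?_ ht)
    omega
  have hdeg : (S.val i).totalDegree ≤ n := by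
    rw [hper]
    simpa using (perPoly_isHomogeneous (n := Fin n) (k := ℂ)).totalDegree_le
  have hcardσ : Fintype.card (Fin n × Fin n) ≤ 2 ^ E := by
    simpa [Fintype.card_prod, Fintype.card_fin] using hcard
  obtain ⟨wq, hwq, M, hM, G, hprod⟩ :=
    BorderQWord.exists_ibq_val_qp stub_ibqAdd stub_ibqSmul stub_ibqCube stub_ibqSquare
      (σ := Fin n × Fin n) S n E i hE hlen hd hcardσ hi hdeg
  rw [hper] at hprod
  have hB : 2 ^ (100 * E ^ 2) ≤ 2 ^ ((Nat.log 2 n + (2 * c₀ + 100)) ^ (2 * c₀ + 100)) :=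
    Nat.pow_le_pow_right (by norm_num)
      (by simpa [hEdef] using perStage_mul_sq_le_pow 100 c₀ (Nat.log 2 n) (by norm_num))
  exact ⟨wq, hwq.trans hB, M, hM.trans hB, G, hprod⟩

end Summit.ValiantsHypothesis.ValiantsHypothesis.Cruxes.WordLengthQP.EpsOrderLadder
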